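import Literature.NumberTheory.Automorphic.TwistedQuotientConeDescent
import Literature.Algebra.Homology.CechTupleFaces
import HarnessLib

/-!
# The staircase on a convex cone, II: the row operators (`δ`, `S_ψ`, `T_ψ`), their identities,
# equivariance and smoothness; `d` commutes with the action

Topic `NumberTheory/Automorphic`; namespace `Literature.NumberTheory.Automorphic.TwistedQuotient`.
Sequel of `TwistedQuotientConeDescent` (definitions): here the identities of the ROWS of the double
complex `C^{p,r}` (equivariant homogeneous `p`-cochains of `Γ` with values in total form families on
`X`) and the first column fact.

* `famAct_add/smul/sum/one/mul` — the action is a linear action; `delta_delta` — `δδ = 0`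
  (`CechTuple.sum_sum_neg_one_pow_smul_smul_faces_eq_zero`); `IsEquivariant.delta`.
* `delta_cochS_add_cochS_delta` — **`δ S + S δ = id`** pointwise wherever `(ψ ∘ a γ⁻¹)_γ` has finite
  support summing to `1` (Bott–Tu's collating homotopy, `CechTuple.sum_neg_one_pow_smul_cons_faces`).
* `actAlt` — the action on one alternating map as an additive EQUIVALENCE, so that it commutes with
  `finsum` unconditionally; `IsEquivariant.cochS` — `S_ψ` preserves equivariance.
* `IsPOU` — a `Γ`-partition of unity on `X` (smooth on `X`, locally finite, `∑ = 1`); its local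
  finite-sum packaging; `wedgeD` algebra; **`delta_cochT_apply` — `δ T_ψ(λ, κ) = δκ` on `X` when
  `δλ = 0` on `X`** (faces of extended tuples telescope, `dψ_γ ∧ δλ(γ, ·) = 0` pointwise, `δδ = 0`,
  `∑ ψ_γ = 1` near the point).
* `SmoothOn`; `SmoothOn.cochS`; `extDeriv_smul_pt` (Leibniz), `extDeriv_finset_sum`;
  **`cochT_eq_cochD_cochS_apply` — `T_ψ(λ, κ) = d(S_ψ λ)` on `X`** when `dλ = δκ` on `X` and `δκ`
  has no degree-`0` part.
* `IsEquivariantOn`; `alternatizeUncurryFin_postcomp`; **`famD_famAct_apply` — `d` commutes with the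
  action** at points of differentiability (Mathlib `extDeriv_pullback`).

Theorems and four small definitions (`actAlt`, `IsPOU`, `SmoothOn`, `IsEquivariantOn`); no named fact,
no `sorry`.  [cite: BottTu1982Forms, §I.4, §II.8–9] [cite: Dupont1976, §1–2]

## References

* R. Bott, L. W. Tu, *Differential Forms in Algebraic Topology*, GTM 82 (1982), §II.8–9 (the Čech–de
  Rham double complex, Prop. 8.5, the collating formula). [BottTu1982Forms]
* J. L. Dupont, Topology 15 (1976), §1–2. [Dupont1976]
-/

noncomputable section

open CategoryTheory Set MeasureTheory
open Literature.Analysis.Calculus Literature.Geometry.Kaehler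

namespace Literature.NumberTheory.Automorphic

namespace TwistedQuotient

variable {Γ 𝒢 : Type} [Group Γ] [Group 𝒢] (ι : Γ →* 𝒢) (L : Subgroup 𝒢)
  {V : Type} [NormedAddCommGroup V] [NormedSpace ℂ V]
  (ρ : Representation ℂ Γ V)
  {W : Type} [NormedAddCommGroup W] [NormedSpace ℝ W]
  (a : Γ →* (W →L[ℝ] W))

/-! ## basic identities -/

section Basic

variable [FiniteDimensional ℂ V]

/-- `famAct` is additive. [folklore] -/
theorem famAct_add (γ : Γ) (α β : TFam L W V) :
    famAct ι L ρ a γ (α + β) = famAct ι L ρ a γ α + famAct ι L ρ a γ β := by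
  funext c r x
  ext v
  simp [famAct_apply]

/-- `famAct` commutes with real scalars. [folklore] -/
theorem famAct_smul (γ : Γ) (t : ℝ) (α : TFam L W V) :
    famAct ι L ρ a γ (t • α) = t • famAct ι L ρ a γ α := by
  funext c r x
  ext v
  simp [famAct_apply]

/-- `famAct` of a finite sum. [folklore] -/
theorem famAct_sum (γ : Γ) {σ : Type*} (s : Finset σ) (α : σ → TFam L W V) :
    famAct ι L ρ a γ (∑ i ∈ s, α i) = ∑ i ∈ s, famAct ι L ρ a γ (α i) := by
  classical
  induction s using Finset.induction_on with
  | empty =>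
    funext c r x
    ext v
    simp [famAct_apply]
  | insert j s hj ih => rw [Finset.sum_insert hj, Finset.sum_insert hj, famAct_add, ih]

/-- `famAct 1 = id`. [folklore] -/
theorem famAct_one (α : TFam L W V) : famAct ι L ρ a 1 α = α := by
  funext c r x
  ext v
  simp [famAct_apply]

/-- `famAct` is an action: `(γ δ) • α = γ • (δ • α)`. [folklore] -/
theorem famAct_mul (γ δ : Γ) (α : TFam L W V) :
    famAct ι L ρ a (γ * δ) α = famAct ι L ρ a γ (famAct ι L ρ a δ α) := by
  funext c r x
  ext v
  simp [famAct_apply, mul_smul]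

omit [Group Γ] [FiniteDimensional ℂ V] in
/-- **`δδ = 0`** for homogeneous cochains (the simplicial identity). [cite: Brown1982CohomologyGroups, I §5] -/
theorem delta_delta {p : ℕ} (φ : Coch Γ L W V p) : delta L (delta L φ) = 0 := by
  funext g
  simp only [delta_apply, Pi.zero_apply, Finset.smul_sum]
  exact Literature.Algebra.Homology.CechTuple.sum_sum_neg_one_pow_smul_smul_faces_eq_zero
    (R := ℝ) fun f : Fin (p + 1) → Fin (p + 3) => φ fun j => g (f j)

/-- **`δ` preserves equivariance.** [folklore] -/
theorem IsEquivariant.delta {p : ℕ} {φ : Coch Γ L W V p} (hφ : IsEquivariant ι L ρ a φ) :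
    IsEquivariant ι L ρ a (delta L φ) := by
  intro γ g
  simp only [delta_apply, famAct_sum, famAct_smul]
  refine Finset.sum_congr rfl fun i _ => ?_
  rw [← hφ γ]

end Basic

/-! ## the row contraction by a partition of unity -/

section Rows

/-- With finite support at `x`, the `finsum` defining `cochS` is a finite sum over any finite set
containing the support of `γ ↦ ψ(a γ⁻¹ x)`. [folklore] -/
theorem cochS_apply_eq_sum (ψ : W → ℝ) {p : ℕ} (φ : Coch Γ L W V (p + 1)) (g : Fin (p + 1) → Γ)
    (c : 𝒢 ⧸ L) (r : ℕ) (x : W) {s : Finset Γ} (hs : ∀ γ, ψ (a γ⁻¹ x) ≠ 0 → γ ∈ s) :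
    cochS L a ψ φ g c r x = ∑ γ ∈ s, ψ (a γ⁻¹ x) • φ (Fin.cons γ g) c r x := by
  rw [cochS_apply]
  refine finsum_eq_sum_of_support_subset _ fun γ hγ => ?_
  rw [Function.mem_support] at hγ
  exact Finset.mem_coe.2 (hs γ fun h => hγ (by rw [h, zero_smul]))

/-- **The row contraction is a contracting homotopy: `δ S + S δ = id`** on `(p+1)`-cochains, at every
point where `γ ↦ ψ(a γ⁻¹ x)` has finite support and sums to `1` (a `Γ`-partition of unity).
[cite: BottTu1982Forms, Prop. 8.5] [cite: Dupont1976, §1–2] -/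
theorem delta_cochS_add_cochS_delta (ψ : W → ℝ) {p : ℕ} (φ : Coch Γ L W V (p + 1))
    (g : Fin (p + 2) → Γ) (c : 𝒢 ⧸ L) (r : ℕ) (x : W) {s : Finset Γ}
    (hs : ∀ γ, ψ (a γ⁻¹ x) ≠ 0 → γ ∈ s) (h1 : ∑ γ ∈ s, ψ (a γ⁻¹ x) = 1) :
    delta L (cochS L a ψ φ) g c r x + cochS L a ψ (delta L φ) g c r x = φ g c r x := by
  -- everything is a finite sum over `s`
  have hS : ∀ (g' : Fin (p + 1) → Γ), cochS L a ψ φ g' c r x =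
      ∑ γ ∈ s, ψ (a γ⁻¹ x) • φ (Fin.cons γ g') c r x :=
    fun g' => cochS_apply_eq_sum L a ψ φ g' c r x hs
  have hSδ : cochS L a ψ (delta L φ) g c r x =
      ∑ γ ∈ s, ψ (a γ⁻¹ x) • delta L φ (Fin.cons γ g) c r x :=
    cochS_apply_eq_sum L a ψ (delta L φ) g c r x hs
  -- the faces of an extended tuple: `(δφ)(γ, g) = φ g - ∑ⱼ (-1)ʲ φ(γ, g ∘ σⱼ)`
  have hface : ∀ γ : Γ, delta L φ (Fin.cons γ g) =
      φ g - ∑ j : Fin (p + 2), ((-1 : ℝ) ^ (j : ℕ)) • φ (Fin.cons γ fun k => g (j.succAbove k)) := by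
    intro γ
    rw [delta_apply]
    exact Literature.Algebra.Homology.CechTuple.sum_neg_one_pow_smul_cons_faces (R := ℝ) γ g φ
  rw [hSδ]
  simp_rw [hface]
  rw [delta_apply]
  simp only [Finset.sum_apply, Pi.smul_apply, hS, Pi.sub_apply, smul_sub, Finset.smul_sum,
    Finset.sum_sub_distrib]
  have h2 : ∑ γ ∈ s, ψ (a γ⁻¹ x) • φ g c r x = φ g c r x := by
    rw [← Finset.sum_smul, h1, one_smul]
  rw [h2]
  have h3 : ∑ i : Fin (p + 2), ∑ γ ∈ s, ((-1 : ℝ) ^ (i : ℕ)) • ψ (a γ⁻¹ x) •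
        φ (Fin.cons γ fun k => g (i.succAbove k)) c r x =
      ∑ γ ∈ s, ∑ j : Fin (p + 2), ψ (a γ⁻¹ x) • ((-1 : ℝ) ^ (j : ℕ)) •
        φ (Fin.cons γ fun k => g (j.succAbove k)) c r x := by
    rw [Finset.sum_comm]
    simp only [smul_smul, mul_comm (ψ _)]
  rw [h3]
  abel

end Rows

/-! ## equivariance of the row operators -/

section RowsEquiv

variable [FiniteDimensional ℂ V]

/-- A translate of an extended tuple is the extended tuple of the translates. [folklore] -/
theorem mul_cons {p : ℕ} (γ δ : Γ) (g : Fin (p + 1) → Γ) :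
    (fun i => δ * (Fin.cons γ g : Fin (p + 2) → Γ) i) = Fin.cons (δ * γ) fun i => δ * g i := by
  funext i
  refine Fin.cases ?_ (fun j => ?_) i
  · simp
  · simp

/-- `a δ⁻¹ (a δ w) = w`. [folklore] -/
theorem act_inv_apply (δ : Γ) (w : W) : a δ⁻¹ (a δ w) = w := by
  rw [← ContinuousLinearMap.comp_apply, ← ContinuousLinearMap.mul_def, ← map_mul, inv_mul_cancel,
    map_one]
  rfl

/-- `a δ (a δ⁻¹ w) = w`. [folklore] -/
theorem act_apply_inv (δ : Γ) (w : W) : a δ (a δ⁻¹ w) = w := by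
  rw [← ContinuousLinearMap.comp_apply, ← ContinuousLinearMap.mul_def, ← map_mul, mul_inv_cancel,
    map_one]
  rfl

omit [FiniteDimensional ℂ V] in
/-- `ρ δ⁻¹ (ρ δ v) = v`. [folklore] -/
theorem coeff_inv_apply (δ : Γ) (v : V) : ρ δ⁻¹ (ρ δ v) = v := by
  rw [← Module.End.mul_apply, ← map_mul, inv_mul_cancel, map_one, Module.End.one_apply]

omit [FiniteDimensional ℂ V] in
/-- `ρ δ (ρ δ⁻¹ v) = v`. [folklore] -/
theorem coeff_apply_inv (δ : Γ) (v : V) : ρ δ (ρ δ⁻¹ v) = v := by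
  rw [← Module.End.mul_apply, ← map_mul, mul_inv_cancel, map_one, Module.End.one_apply]

/-- The action of `δ` on a single alternating map, `M ↦ ρ(δ) ∘ M ∘ ∧ a(δ⁻¹)`, as an additive
EQUIVALENCE (inverse: the action of `δ⁻¹`) — so that it commutes with `finsum` unconditionally.
[folklore] -/
def actAlt (δ : Γ) (r : ℕ) : (W [⋀^Fin r]→L[ℝ] V) ≃+ (W [⋀^Fin r]→L[ℝ] V) where
  toFun M := (ρCLM ρ δ).compContinuousAlternatingMap (M.compContinuousLinearMap (a δ⁻¹))
  invFun M := (ρCLM ρ δ⁻¹).compContinuousAlternatingMap (M.compContinuousLinearMap (a δ))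
  left_inv M := by
    ext v
    simp [Function.comp_def, act_inv_apply]
  right_inv M := by
    ext v
    simp [Function.comp_def, act_apply_inv]
  map_add' M N := by
    ext v
    simp

/-- Unfolding. [folklore] -/
theorem actAlt_apply (δ : Γ) (r : ℕ) (M : W [⋀^Fin r]→L[ℝ] V) (v : Fin r → W) :
    actAlt ρ a δ r M v = ρ δ (M fun i => a δ⁻¹ (v i)) :=
  rfl

/-- `actAlt` commutes with real scalars. [folklore] -/
theorem actAlt_smul (δ : Γ) (r : ℕ) (t : ℝ) (M : W [⋀^Fin r]→L[ℝ] V) :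
    actAlt ρ a δ r (t • M) = t • actAlt ρ a δ r M := by
  ext v
  simp [actAlt_apply]

/-- `famAct` is `actAlt` pointwise. [folklore] -/
theorem famAct_eq_actAlt (δ : Γ) (α : TFam L W V) (c : 𝒢 ⧸ L) (r : ℕ) (x : W) :
    famAct ι L ρ a δ α c r x = actAlt ρ a δ r (α ((ι δ)⁻¹ • c) r (a δ⁻¹ x)) :=
  rfl

omit [FiniteDimensional ℂ V] in
/-- `ψ(a (δγ)⁻¹ x) = ψ(a γ⁻¹ (a δ⁻¹ x))`. [folklore] -/
theorem psi_mul_inv (ψ : W → ℝ) (δ γ : Γ) (x : W) : ψ (a (δ * γ)⁻¹ x) = ψ (a γ⁻¹ (a δ⁻¹ x)) := by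
  rw [mul_inv_rev, map_mul]
  rfl

/-- **The row contraction preserves equivariance** (reindex `γ ↦ δ γ`; the action, an additive
equivalence, commutes with the locally finite sums unconditionally). [cite: Dupont1976, §1–2] -/
theorem IsEquivariant.cochS (ψ : W → ℝ) {p : ℕ} {φ : Coch Γ L W V (p + 1)}
    (hφ : IsEquivariant ι L ρ a φ) : IsEquivariant ι L ρ a (cochS L a ψ φ) := by
  intro δ g
  funext c r x
  rw [cochS_apply, famAct_eq_actAlt, cochS_apply, AddEquiv.map_finsum]
  -- reindex the left sum by `γ ↦ δ * γ`
  rw [← finsum_comp (Equiv.mulLeft δ) (Equiv.bijective _)]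
  refine finsum_congr fun γ => ?_
  have hγ : φ (Fin.cons (δ * γ) fun i => δ * g i) = famAct ι L ρ a δ (φ (Fin.cons γ g)) := by
    rw [← mul_cons, hφ]
  rw [Equiv.coe_mulLeft, hγ, famAct_eq_actAlt, actAlt_smul, psi_mul_inv a ψ δ γ x]

end RowsEquiv

/-! ## partitions of unity and the descent correction -/

section POU

open Filter Topology
open scoped ContDiff Topology

/-- **A `Γ`-partition of unity on `X`**: `ψ` is smooth on `X`, the family `(ψ ∘ a γ⁻¹)_γ` is
locally finite on `X`, and it sums to `1` on `X`. [cite: BottTu1982Forms, §II.8] -/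
structure IsPOU (X : Set W) (ψ : W → ℝ) : Prop where
  contDiffOn : ContDiffOn ℝ ∞ ψ X
  locFinite : ∀ x ∈ X, ∃ U ∈ 𝓝 x, {γ : Γ | ∃ y ∈ U, ψ (a γ⁻¹ y) ≠ 0}.Finite
  sum_eq_one : ∀ x ∈ X, ∑ᶠ γ : Γ, ψ (a γ⁻¹ x) = 1

variable {a} {X : Set W} {ψ : W → ℝ}

/-- **Local finiteness, packaged**: near `x ∈ X` there are a neighbourhood `U` and a finite set `s`
of group elements off which every `ψ ∘ a γ⁻¹` vanishes identically on `U`. [folklore] -/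
theorem IsPOU.exists_finset (hψ : IsPOU (Γ := Γ) a X ψ) {x : W} (hx : x ∈ X) :
    ∃ U ∈ 𝓝 x, ∃ s : Finset Γ, ∀ y ∈ U, ∀ γ : Γ, ψ (a γ⁻¹ y) ≠ 0 → γ ∈ s := by
  obtain ⟨U, hU, hfin⟩ := hψ.locFinite x hx
  refine ⟨U, hU, hfin.toFinset, fun y hy γ hγ => ?_⟩
  exact hfin.mem_toFinset.2 ⟨y, hy, hγ⟩

/-- Off the finite set, `ψ ∘ a γ⁻¹` vanishes near `x`, hence so does its derivative at `x`.
[folklore] -/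
theorem fderiv_psi_eq_zero_of_notMem {x : W} {U : Set W} (hU : U ∈ 𝓝 x) {s : Finset Γ}
    (hs : ∀ y ∈ U, ∀ γ : Γ, ψ (a γ⁻¹ y) ≠ 0 → γ ∈ s) {γ : Γ} (hγ : γ ∉ s) :
    fderiv ℝ (fun y => ψ (a γ⁻¹ y)) x = 0 := by
  have h0 : (fun y => ψ (a γ⁻¹ y)) =ᶠ[𝓝 x] fun _ => 0 := by
    filter_upwards [hU] with y hy
    by_contra h
    exact hγ (hs y hy γ h)
  rw [h0.fderiv_eq, fderiv_const_apply]

/-- On a `Γ`-stable open `X`, each `ψ ∘ a γ⁻¹` is differentiable at the points of `X`. [folklore] -/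
theorem IsPOU.differentiableAt_psi (hψ : IsPOU (Γ := Γ) a X ψ) (hXo : IsOpen X)
    (hmaps : ∀ γ : Γ, MapsTo (a γ) X X) (γ : Γ) {x : W} (hx : x ∈ X) :
    DifferentiableAt ℝ (fun y => ψ (a γ⁻¹ y)) x := by
  have hx' : a γ⁻¹ x ∈ X := hmaps γ⁻¹ hx
  have hd : DifferentiableAt ℝ ψ (a γ⁻¹ x) :=
    ((hψ.contDiffOn.contDiffAt (hXo.mem_nhds hx')).differentiableAt (by simp))
  exact hd.comp x (a γ⁻¹).differentiableAt

/-- **The finite sum `∑_{γ ∈ s} ψ ∘ a γ⁻¹` is identically `1` near `x`**, hence has zero derivative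
at `x`. [folklore] -/
theorem IsPOU.fderiv_sum_psi_eq_zero (hψ : IsPOU (Γ := Γ) a X ψ) (hXo : IsOpen X) {x : W} (hx : x ∈ X)
    {U : Set W} (hU : U ∈ 𝓝 x) {s : Finset Γ} (hs : ∀ y ∈ U, ∀ γ : Γ, ψ (a γ⁻¹ y) ≠ 0 → γ ∈ s) :
    fderiv ℝ (fun y => ∑ γ ∈ s, ψ (a γ⁻¹ y)) x = 0 := by
  have h1 : (fun y => ∑ γ ∈ s, ψ (a γ⁻¹ y)) =ᶠ[𝓝 x] fun _ => (1 : ℝ) := by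
    filter_upwards [hU, hXo.mem_nhds hx] with y hy hyX
    rw [← hψ.sum_eq_one y hyX]
    refine (finsum_eq_sum_of_support_subset _ fun γ hγ => ?_).symm
    exact Finset.mem_coe.2 (hs y hy γ (Function.mem_support.1 hγ))
  rw [h1.fderiv_eq, fderiv_const_apply]

variable (a)

/-- `wedgeD` only sees the value of the family at the point. [folklore] -/
theorem wedgeD_congr_pt (f : W → ℝ) {α β : TFam L W V} {c : 𝒢 ⧸ L} {r : ℕ} {x : W}
    (h : α c r x = β c r x) : wedgeD L f α c (r + 1) x = wedgeD L f β c (r + 1) x := by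
  rw [wedgeD_succ, wedgeD_succ, h]

/-- `wedgeD` is additive in the family (pointwise). [folklore] -/
theorem wedgeD_add_fam (f : W → ℝ) (α β : TFam L W V) (c : 𝒢 ⧸ L) (r : ℕ) (x : W) :
    wedgeD L f (α + β) c r x = wedgeD L f α c r x + wedgeD L f β c r x := by
  cases r with
  | zero => simp
  | succ r =>
    simp only [wedgeD_succ, Pi.add_apply]
    rw [← ContinuousAlternatingMap.alternatizeUncurryFin_add]
    congr 1
    ext w v
    simp

/-- `wedgeD` commutes with real scalars in the family (pointwise). [folklore] -/
theorem wedgeD_smul_fam (f : W → ℝ) (t : ℝ) (α : TFam L W V) (c : 𝒢 ⧸ L) (r : ℕ) (x : W) :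
    wedgeD L f (t • α) c r x = t • wedgeD L f α c r x := by
  cases r with
  | zero => simp
  | succ r =>
    simp only [wedgeD_succ, Pi.smul_apply]
    rw [← ContinuousAlternatingMap.alternatizeUncurryFin_smul]
    congr 1
    ext w v
    simp only [ContinuousLinearMap.smulRight_apply, ContinuousAlternatingMap.smul_apply,
      FunLike.coe_smul, Pi.smul_apply]
    rw [smul_comm]

/-- `wedgeD` of a finite linear combination of families (pointwise). [folklore] -/
theorem wedgeD_sum_smul_fam (f : W → ℝ) {σ : Type*} (S : Finset σ) (t : σ → ℝ)
    (α : σ → TFam L W V) (c : 𝒢 ⧸ L) (r : ℕ) (x : W) :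
    wedgeD L f (∑ i ∈ S, t i • α i) c r x = ∑ i ∈ S, t i • wedgeD L f (α i) c r x := by
  classical
  induction S using Finset.induction_on with
  | empty =>
    cases r with
    | zero => simp
    | succ r =>
      simp only [Finset.sum_empty, wedgeD_succ, Pi.zero_apply, ContinuousLinearMap.smulRight_zero]
      exact map_zero (ContinuousAlternatingMap.alternatizeUncurryFinCLM ℝ W V)
  | insert j S hj ih => rw [Finset.sum_insert hj, Finset.sum_insert hj, wedgeD_add_fam, wedgeD_smul_fam, ih]

/-- `wedgeD` is additive in the function at points of differentiability. [folklore] -/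
theorem wedgeD_add_fun {f g : W → ℝ} (α : TFam L W V) (c : 𝒢 ⧸ L) (r : ℕ) {x : W}
    (hf : DifferentiableAt ℝ f x) (hg : DifferentiableAt ℝ g x) :
    wedgeD L (fun y => f y + g y) α c r x = wedgeD L f α c r x + wedgeD L g α c r x := by
  cases r with
  | zero => simp
  | succ r =>
    simp only [wedgeD_succ]
    rw [fderiv_fun_add hf hg, ← ContinuousAlternatingMap.alternatizeUncurryFin_add]
    congr 1
    ext w v
    simp [add_smul]

end POU

/-! ## the simplicial coboundary of the descent correction -/

section DeltaT

open Filter Topology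
open scoped ContDiff Topology

variable {a} {X : Set W} {ψ : W → ℝ}

/-- The `cochT` finsum at a point of local finiteness is a finite sum. [folklore] -/
theorem cochT_apply_eq_sum {p : ℕ} (lam : Coch Γ L W V (p + 1)) (κ : Coch Γ L W V p)
    (g : Fin (p + 1) → Γ) (c : 𝒢 ⧸ L) (r : ℕ) {x : W} {U : Set W} (hU : U ∈ 𝓝 x) {s : Finset Γ}
    (hs : ∀ y ∈ U, ∀ γ : Γ, ψ (a γ⁻¹ y) ≠ 0 → γ ∈ s) :
    cochT L a ψ lam κ g c r x = ∑ γ ∈ s,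
      (wedgeD L (fun y => ψ (a γ⁻¹ y)) (lam (Fin.cons γ g)) c r x +
        ψ (a γ⁻¹ x) • delta L κ (Fin.cons γ g) c r x) := by
  rw [cochT_apply]
  refine finsum_eq_sum_of_support_subset _ fun γ hγ => ?_
  rw [Function.mem_support] at hγ
  by_contra hγs
  refine hγ ?_
  have hγs' : γ ∉ s := fun h => hγs (Finset.mem_coe.2 h)
  have h0 : ψ (a γ⁻¹ x) = 0 := by
    by_contra h
    exact hγs' (hs x (mem_of_mem_nhds hU) γ h)
  have hd : fderiv ℝ (fun y => ψ (a γ⁻¹ y)) x = 0 := fderiv_psi_eq_zero_of_notMem hU hs hγs'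
  rw [h0, zero_smul, add_zero]
  cases r with
  | zero => simp
  | succ r =>
    rw [wedgeD_succ, hd, ContinuousLinearMap.zero_smulRight]
    exact map_zero (ContinuousAlternatingMap.alternatizeUncurryFinCLM ℝ W V)

/-- `wedgeD` vanishes when the function has zero derivative at the point. [folklore] -/
theorem wedgeD_eq_zero_of_fderiv {f : W → ℝ} {x : W} (hf : fderiv ℝ f x = 0) (α : TFam L W V)
    (c : 𝒢 ⧸ L) (r : ℕ) : wedgeD L f α c r x = 0 := by
  cases r with
  | zero => simp
  | succ r =>
    rw [wedgeD_succ, hf, ContinuousLinearMap.zero_smulRight]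
    exact map_zero (ContinuousAlternatingMap.alternatizeUncurryFinCLM ℝ W V)

/-- `wedgeD` of a finite sum of functions, each differentiable at the point. [folklore] -/
theorem wedgeD_finset_sum_fun {σ : Type*} (S : Finset σ) {f : σ → W → ℝ} (α : TFam L W V)
    (c : 𝒢 ⧸ L) (r : ℕ) {x : W} (hf : ∀ i ∈ S, DifferentiableAt ℝ (f i) x) :
    wedgeD L (fun y => ∑ i ∈ S, f i y) α c r x = ∑ i ∈ S, wedgeD L (f i) α c r x := by
  classical
  induction S using Finset.induction_on with
  | empty =>
    simp only [Finset.sum_empty]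
    exact wedgeD_eq_zero_of_fderiv L (by simp) α c r
  | insert j S hj ih =>
    have hS : ∀ i ∈ S, DifferentiableAt ℝ (f i) x := fun i hi => hf i (Finset.mem_insert_of_mem hi)
    have hsum : DifferentiableAt ℝ (fun y => ∑ i ∈ S, f i y) x := by
      have := DifferentiableAt.fun_sum (u := S) (A := fun i y => f i y) (fun i hi => hS i hi)
      simpa using this
    simp only [Finset.sum_insert hj]
    rw [wedgeD_add_fun L α c r (hf j (Finset.mem_insert_self j S)) hsum, ih hS]

/-- **`δ T_ψ(λ, κ) = δκ` on `X`** when `δλ = 0` on `X`: the faces of the extended tuples telescope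
(`∑ᵢ (-1)ⁱ F(γ, g ∘ σᵢ) = F(g) - (δF)(γ, g)`), `dψ_γ ∧ (δλ)(γ, g) = 0` and `δδκ = 0` pointwise, and
`∑_γ ψ_γ = 1` near `x` kills `∑_γ dψ_γ ∧ λ(g)` and normalises `∑_γ ψ_γ δκ(g)`.
[cite: BottTu1982Forms, §II.9] -/
theorem delta_cochT_apply (hψ : IsPOU (Γ := Γ) a X ψ) (hXo : IsOpen X)
    (hmaps : ∀ γ : Γ, MapsTo (a γ) X X) {p : ℕ} (lam : Coch Γ L W V (p + 1)) (κ : Coch Γ L W V p)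
    (hδlam : ∀ (g : Fin (p + 3) → Γ) (c : 𝒢 ⧸ L) (r : ℕ), ∀ x ∈ X, delta L lam g c r x = 0)
    (g : Fin (p + 2) → Γ) (c : 𝒢 ⧸ L) (r : ℕ) {x : W} (hx : x ∈ X) :
    delta L (cochT L a ψ lam κ) g c r x = delta L κ g c r x := by
  obtain ⟨U, hU, s, hs⟩ := hψ.exists_finset hx
  -- every `cochT` at `x` is a finite sum over `s`
  have hT : ∀ g' : Fin (p + 1) → Γ, cochT L a ψ lam κ g' c r x = ∑ γ ∈ s,
      (wedgeD L (fun y => ψ (a γ⁻¹ y)) (lam (Fin.cons γ g')) c r x +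
        ψ (a γ⁻¹ x) • delta L κ (Fin.cons γ g') c r x) :=
    fun g' => cochT_apply_eq_sum L lam κ g' c r hU hs
  -- telescoping over the faces of the extended tuples
  have hfacelam : ∀ γ : Γ, ∑ i : Fin (p + 2), ((-1 : ℝ) ^ (i : ℕ)) • lam (Fin.cons γ fun k => g (i.succAbove k)) =
      lam g - delta L lam (Fin.cons γ g) := by
    intro γ
    have h := Literature.Algebra.Homology.CechTuple.sum_neg_one_pow_smul_cons_faces (R := ℝ) γ g lam
    simp only [Function.comp_def] at h
    rw [delta_apply, h]
    abel
  have hfaceκ : ∀ γ : Γ, ∑ i : Fin (p + 2), ((-1 : ℝ) ^ (i : ℕ)) • delta L κ (Fin.cons γ fun k => g (i.succAbove k)) =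
      delta L κ g := by
    intro γ
    have h := Literature.Algebra.Homology.CechTuple.sum_neg_one_pow_smul_cons_faces (R := ℝ) γ g (delta L κ)
    simp only [Function.comp_def] at h
    have hdd : delta L (delta L κ) (Fin.cons γ g) = 0 := by rw [delta_delta]; rfl
    rw [delta_apply] at hdd
    rw [hdd] at h
    -- `0 = δκ g - ∑ⱼ …`
    exact (sub_eq_zero.1 h.symm).symm
  rw [delta_apply]
  simp only [Finset.sum_apply, Pi.smul_apply, hT, Finset.smul_sum, smul_add]
  rw [Finset.sum_comm]
  simp only [Finset.sum_add_distrib]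
  -- first group: `∑_γ ∑ᵢ (-1)ⁱ dψ_γ ∧ λ(γ, g∘σᵢ) = ∑_γ dψ_γ ∧ λ(g) = d(∑_γ ψ_γ) ∧ λ(g) = 0`
  have h1 : ∀ γ ∈ s, ∑ i : Fin (p + 2), ((-1 : ℝ) ^ (i : ℕ)) •
      wedgeD L (fun y => ψ (a γ⁻¹ y)) (lam (Fin.cons γ fun k => g (i.succAbove k))) c r x =
      wedgeD L (fun y => ψ (a γ⁻¹ y)) (lam g) c r x := by
    intro γ _
    rw [← wedgeD_sum_smul_fam, hfacelam γ]
    cases r with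
    | zero => simp
    | succ r =>
      refine wedgeD_congr_pt L _ ?_
      rw [Pi.sub_apply, Pi.sub_apply, Pi.sub_apply, hδlam _ c r x hx, sub_zero]
  have h2 : ∀ γ ∈ s, ∑ i : Fin (p + 2), ((-1 : ℝ) ^ (i : ℕ)) •
      (ψ (a γ⁻¹ x) • delta L κ (Fin.cons γ fun k => g (i.succAbove k)) c r x) =
      ψ (a γ⁻¹ x) • delta L κ g c r x := by
    intro γ _
    simp_rw [smul_comm ((-1 : ℝ) ^ _) (ψ _)]
    rw [← Finset.smul_sum]
    congr 1
    have := congrArg (fun φ : TFam L W V => φ c r x) (hfaceκ γ)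
    simpa only [Finset.sum_apply, Pi.smul_apply] using this
  rw [Finset.sum_congr rfl h1, Finset.sum_congr rfl h2, ← Finset.sum_smul]
  -- `∑_{γ ∈ s} ψ_γ(x) = 1`
  have hsum1 : ∑ γ ∈ s, ψ (a γ⁻¹ x) = 1 := by
    rw [← hψ.sum_eq_one x hx]
    refine (finsum_eq_sum_of_support_subset _ fun γ hγ => ?_).symm
    exact Finset.mem_coe.2 (hs x (mem_of_mem_nhds hU) γ (Function.mem_support.1 hγ))
  rw [hsum1, one_smul, ← wedgeD_finset_sum_fun L s (lam g) c r
    (fun γ _ => hψ.differentiableAt_psi hXo hmaps γ hx),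
    wedgeD_eq_zero_of_fderiv L (hψ.fderiv_sum_psi_eq_zero hXo hx hU hs), zero_add]

end DeltaT

/-! ## smoothness of the row operators and `T = d S λ` -/

section Smooth

open Filter Topology
open scoped ContDiff Topology

variable {a} {X : Set W} {ψ : W → ℝ}

omit [Group Γ] in
/-- **Smoothness of a cochain on `X`**: every component is `C^∞` on `X`. [folklore] -/
def SmoothOn (X : Set W) {p : ℕ} (φ : Coch Γ L W V p) : Prop :=
  ∀ (g : Fin (p + 1) → Γ) (c : 𝒢 ⧸ L) (r : ℕ), ContDiffOn ℝ ∞ (φ g c r) X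

/-- Near a point of `X` the row contraction is a FINITE sum. [folklore] -/
theorem cochS_eventuallyEq_sum {p : ℕ} (φ : Coch Γ L W V (p + 1))
    (g : Fin (p + 1) → Γ) (c : 𝒢 ⧸ L) (r : ℕ) {x : W} {U : Set W} (hU : U ∈ 𝓝 x) {s : Finset Γ}
    (hs : ∀ y ∈ U, ∀ γ : Γ, ψ (a γ⁻¹ y) ≠ 0 → γ ∈ s) :
    cochS L a ψ φ g c r =ᶠ[𝓝 x] fun y => ∑ γ ∈ s, ψ (a γ⁻¹ y) • φ (Fin.cons γ g) c r y := by
  filter_upwards [hU] with y hy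
  exact cochS_apply_eq_sum L a ψ φ g c r y fun γ hγ => hs y hy γ hγ

/-- Each `ψ ∘ a γ⁻¹` is `C^∞` at the points of the `Γ`-stable open `X`. [folklore] -/
theorem IsPOU.contDiffAt_psi (hψ : IsPOU (Γ := Γ) a X ψ) (hXo : IsOpen X)
    (hmaps : ∀ γ : Γ, MapsTo (a γ) X X) (γ : Γ) {x : W} (hx : x ∈ X) :
    ContDiffAt ℝ ∞ (fun y => ψ (a γ⁻¹ y)) x :=
  (hψ.contDiffOn.contDiffAt (hXo.mem_nhds (hmaps γ⁻¹ hx))).comp x (a γ⁻¹).contDiff.contDiffAt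

/-- **The row contraction of a smooth cochain is smooth on `X`.** [cite: BottTu1982Forms, §II.8] -/
theorem SmoothOn.cochS (hψ : IsPOU (Γ := Γ) a X ψ) (hXo : IsOpen X)
    (hmaps : ∀ γ : Γ, MapsTo (a γ) X X) {p : ℕ} {φ : Coch Γ L W V (p + 1)} (hφ : SmoothOn L X φ) :
    SmoothOn L X (cochS L a ψ φ) := by
  intro g c r x hx
  obtain ⟨U, hU, s, hs⟩ := hψ.exists_finset hx
  have hsum : ContDiffAt ℝ ∞ (fun y => ∑ γ ∈ s, ψ (a γ⁻¹ y) • φ (Fin.cons γ g) c r y) x :=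
    ContDiffAt.sum fun γ _ =>
      (hψ.contDiffAt_psi hXo hmaps γ hx).smul ((hφ _ c r).contDiffAt (hXo.mem_nhds hx))
  exact (hsum.congr_of_eventuallyEq (cochS_eventuallyEq_sum L φ g c r hU hs)).contDiffWithinAt

omit [Group 𝒢] in
/-- **Leibniz for `extDeriv` of a scalar multiple** (pointwise): `d(f α) = df ∧ α + f dα`.
[folklore] -/
theorem extDeriv_smul_pt {f : W → ℝ} {r : ℕ} {β : W → W [⋀^Fin r]→L[ℝ] V} {x : W}
    (hf : DifferentiableAt ℝ f x) (hβ : DifferentiableAt ℝ β x) :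
    extDeriv (fun y => f y • β y) x =
      ContinuousAlternatingMap.alternatizeUncurryFin ((fderiv ℝ f x).smulRight (β x)) + f x • extDeriv β x := by
  have hd : HasFDerivAt (fun y => f y • β y) (f x • fderiv ℝ β x + (fderiv ℝ f x).smulRight (β x)) x :=
    hf.hasFDerivAt.smul hβ.hasFDerivAt
  simp only [extDeriv]
  rw [hd.fderiv, ContinuousAlternatingMap.alternatizeUncurryFin_add,
    ContinuousAlternatingMap.alternatizeUncurryFin_smul]
  exact add_comm _ _

omit [Group 𝒢] in
/-- `extDeriv` of a finite sum of forms differentiable at the point. [folklore] -/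
theorem extDeriv_finset_sum {σ : Type*} (S : Finset σ) {r : ℕ} {β : σ → W → W [⋀^Fin r]→L[ℝ] V}
    {x : W} (hβ : ∀ i ∈ S, DifferentiableAt ℝ (β i) x) :
    extDeriv (fun y => ∑ i ∈ S, β i y) x = ∑ i ∈ S, extDeriv (β i) x := by
  classical
  induction S using Finset.induction_on with
  | empty =>
    simp only [Finset.sum_empty]
    simp [extDeriv]
    exact map_zero (ContinuousAlternatingMap.alternatizeUncurryFinCLM ℝ W V)
  | insert j S hj ih =>
    have hS : ∀ i ∈ S, DifferentiableAt ℝ (β i) x := fun i hi => hβ i (Finset.mem_insert_of_mem hi)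
    have hsum : DifferentiableAt ℝ (fun y => ∑ i ∈ S, β i y) x := by
      have := DifferentiableAt.fun_sum (u := S) (A := fun i y => β i y) (fun i hi => hS i hi)
      simpa using this
    simp only [Finset.sum_insert hj]
    rw [extDeriv_fun_add (hβ j (Finset.mem_insert_self j S)) hsum, ih hS]

/-- **`T_ψ(λ, κ) = d(S_ψ λ)` on `X`** when `dλ = δκ` on `X` and `δκ` has no degree-`0` part
(Leibniz on the locally finite sum). [cite: BottTu1982Forms, §II.9] -/
theorem cochT_eq_cochD_cochS_apply (hψ : IsPOU (Γ := Γ) a X ψ) (hXo : IsOpen X)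
    (hmaps : ∀ γ : Γ, MapsTo (a γ) X X) {p : ℕ} {lam : Coch Γ L W V (p + 1)} {κ : Coch Γ L W V p}
    (hlam : SmoothOn L X lam)
    (hd : ∀ (g : Fin (p + 2) → Γ) (c : 𝒢 ⧸ L) (r : ℕ), ∀ x ∈ X, cochD L lam g c r x = delta L κ g c r x)
    (hκ0 : ∀ (g : Fin (p + 2) → Γ) (c : 𝒢 ⧸ L), ∀ x ∈ X, delta L κ g c 0 x = 0)
    (g : Fin (p + 1) → Γ) (c : 𝒢 ⧸ L) (r : ℕ) {x : W} (hx : x ∈ X) :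
    cochT L a ψ lam κ g c r x = cochD L (cochS L a ψ lam) g c r x := by
  obtain ⟨U, hU, s, hs⟩ := hψ.exists_finset hx
  rw [cochT_apply_eq_sum L lam κ g c r hU hs, cochD_apply]
  cases r with
  | zero =>
    simp only [wedgeD_zero, zero_add, famD_zero, Pi.zero_apply]
    exact Finset.sum_eq_zero fun γ _ => by rw [hκ0 _ c x hx, smul_zero]
  | succ r =>
    rw [famD_succ, (cochS_eventuallyEq_sum L lam g c r hU hs).extDeriv_eq,
      extDeriv_finset_sum s fun γ _ => ?_]
    · refine Finset.sum_congr rfl fun γ _ => ?_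
      rw [extDeriv_smul_pt (hψ.differentiableAt_psi hXo hmaps γ hx)
        (((hlam _ c r).contDiffAt (hXo.mem_nhds hx)).differentiableAt (by simp)), wedgeD_succ,
        ← hd _ c (r + 1) x hx, cochD_apply, famD_succ]
    · exact (hψ.differentiableAt_psi hXo hmaps γ hx).smul
        (((hlam _ c r).contDiffAt (hXo.mem_nhds hx)).differentiableAt (by simp))

end Smooth

/-! ## equivariance of `d`, the descent step -/

section Step

open Filter Topology
open scoped Topology

variable [FiniteDimensional ℂ V]
variable {a} {X : Set W} {ψ : W → ℝ}

/-- **Equivariance on `X`** of a homogeneous cochain. [cite: Dupont1976, §1–2] -/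
def IsEquivariantOn (X : Set W) {p : ℕ} (φ : Coch Γ L W V p) : Prop :=
  ∀ (γ : Γ) (g : Fin (p + 1) → Γ) (c : 𝒢 ⧸ L) (r : ℕ), ∀ x ∈ X,
    φ (fun i => γ * g i) c r x = famAct ι L ρ a γ (φ g) c r x

omit [Group 𝒢] [FiniteDimensional ℂ V] in
/-- `alternatizeUncurryFin` commutes with postcomposition by a continuous linear map. [folklore] -/
theorem alternatizeUncurryFin_postcomp {G : Type} [NormedAddCommGroup G] [NormedSpace ℝ G] {r : ℕ}
    (T : V →L[ℝ] G) (Lf : W →L[ℝ] W [⋀^Fin r]→L[ℝ] V) :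
    ContinuousAlternatingMap.alternatizeUncurryFin
        ((ContinuousLinearMap.compContinuousAlternatingMapCLM ℝ W V G (Fin r) T).comp Lf) =
      T.compContinuousAlternatingMap (ContinuousAlternatingMap.alternatizeUncurryFin Lf) := by
  ext v
  simp [ContinuousAlternatingMap.alternatizeUncurryFin_apply, map_sum]

/-- **`d` commutes with the action** at points of differentiability (`A = a γ⁻¹` linear:
`d((T ∘ ω ∘ A) ∘ ∧A) = T ∘ (dω ∘ A) ∘ ∧A`, Mathlib `extDeriv_pullback`). [cite: BottTu1982Forms, §I.1] -/
theorem famD_famAct_apply (γ : Γ) (α : TFam L W V) (c : 𝒢 ⧸ L) (r : ℕ) {x : W}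
    (hα : DifferentiableAt ℝ (α ((ι γ)⁻¹ • c) r) (a γ⁻¹ x)) :
    famD L (famAct ι L ρ a γ α) c (r + 1) x = famAct ι L ρ a γ (famD L α) c (r + 1) x := by
  rw [famD_succ]
  set A : W →L[ℝ] W := a γ⁻¹
  set T : V →L[ℝ] V := ρCLM ρ γ
  set om : W → W [⋀^Fin r]→L[ℝ] V := α ((ι γ)⁻¹ • c) r
  -- the pullback `x ↦ (ω (A x)).compCLM A`, then postcomposition by `T`
  have hpull : extDeriv (fun y => (om (A y)).compContinuousLinearMap A) x =
      (extDeriv om (A x)).compContinuousLinearMap A := by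
    have h2 : minSmoothness ℝ 2 ≤ (2 : WithTop ℕ∞) := by simp
    have h := extDeriv_pullback (ω := om) (f := fun y => A y) (x := x) (r := 2)
      (by simpa using hα) A.contDiff.contDiffAt h2
    simpa only [ContinuousLinearMap.fderiv] using h
  have hA : DifferentiableAt ℝ (fun y => A y) x := A.differentiableAt
  have hdiff : DifferentiableAt ℝ (fun y => (om (A y)).compContinuousLinearMap A) x :=
    (hα.comp x hA).continuousAlternatingMapCompContinuousLinearMap (differentiableAt_const A)
  have hpost : extDeriv (fun y => T.compContinuousAlternatingMap ((om (A y)).compContinuousLinearMap A)) x =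
      T.compContinuousAlternatingMap (extDeriv (fun y => (om (A y)).compContinuousLinearMap A) x) := by
    simp only [extDeriv]
    have hT := ((ContinuousLinearMap.compContinuousAlternatingMapCLM ℝ W V V (Fin r) T).hasFDerivAt.comp x
      hdiff.hasFDerivAt).fderiv
    rw [show (fun y => T.compContinuousAlternatingMap ((om (A y)).compContinuousLinearMap A)) =
        (ContinuousLinearMap.compContinuousAlternatingMapCLM ℝ W V V (Fin r) T) ∘
          fun y => (om (A y)).compContinuousLinearMap A from rfl, hT, alternatizeUncurryFin_postcomp]
  change extDeriv (fun y => T.compContinuousAlternatingMap ((om (A y)).compContinuousLinearMap A)) x = _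
  rw [hpost, hpull]
  rfl

end Step

end TwistedQuotient

end Literature.NumberTheory.Automorphic

end
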